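import Mathlib
import HarnessLib.Audit
import Summits.PneNP.PneNP.Theorems.PstarMultiSiblingSquare
import Summits.PneNP.PneNP.Theorems.PstarMemberKillCores

/-!
# The member with several siblings (II): `Γ₂` misses `b₂` on the big slice, (M0) fails (ROUND-24, O1; memo g29 §83)

FRONTIER range-avoidance ladder, rung F-N3, ROUND 24 (cell `pnp-ideate`, prover-2 memo `g29/O1-SIBLINGS-g29.md` §83; census node
`PstarLocalGateBudgetAssembly.LocalMenuCriterionBoundGateBudget`; restricted-model proof complexity — nothing here bears on `P` versus `NP`).

Conclusion of `PstarMultiSiblingSquare` (setting `Setup I K w₁ w₂ e σ p S q`: member `e = (σ, p)` of `K`, `p` private, sibling set `S`, sibling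
`o = (σ, q o)` with `q o` private, every output of `K ∪ G₁` through `σ` being `e` or a sibling — the g27 §74 kill WITHOUT the one-sibling
restriction `hσonly`, g28 §80.4 LEFT (1)):

* **`gval_ne_on_sliceBut`** — (T3) on `A`, `A₁ = A ∩ {x_σ = 0} ≠ ∅`, and every `Γ₂`-gate partner `u` OFF THE BLOCK (`u ≠ σ, p` and `u ≠ q o`
  for all siblings) of a block variable `v ∈ {p, σ} ∪ q(S)` FROZEN on `Ā` or THAWED in `A₁` (gates through block variables unique — simple
  overlaps) ⇒ gates inside the block other than the excluded member pairs are impossible, all partners are frozen, the slopes `L_p, L_{q o}, L_σ`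
  vanish on all of `Ā = Sol(K ∖ e) ∩ {Γ₁ = b₁}`, and `Γ₂ ≠ b₂` at EVERY point of `Ā` (`x_σ = 1`: flip `p`; `x_σ = 0`: set `p := 1`, clamp every
  `q o := 0`, flip `σ`);
* **`false_of_multi_sibling`** — hence `¬ SatPair K ∧ SatPair (K ∖ e)` ((T3) + (M0) at `e`) is contradictory; **`not_terminal_of_multi_sibling`**,
  **`not_terminalNC_of_multi_sibling`** — the pair is not terminal, the sub-core is not a `TerminalNC` core;
* **`not_terminal_of_untouched`** / **`not_terminalNC_of_untouched`** — in particular `Γ₂` must TOUCH the block (some monomial through `σ`, `p` or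
  a `q o`) of every such member with unpinned literal: p3's «the second reader sees every defect», now for literals of any sharing degree.

So the member-kill calculus of g27 §72/§74 + g28 §76–§82 treats, for a member with a private AND variable: dirty (`PstarDirtyMemberSquare`),
literal UNPINNED ON `A` (`A₁ ≠ ∅`) with any number of siblings (this file), literal PINNED ON `Ā` (`PstarPinnedSigmaMember`).  The remaining regime —
`x_σ ≡ 1` on `A` but `σ` unpinned on `Ā` (every value-`1` one-block join through `σ` contains `e`) — is not killed by these files: it contains p3's
transparent class (`PstarCycleCorePinning.release_on_cycle`), where certificates exist; what holds there regardless is `PstarInvisibleMember`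
(memo g29 §85/§87).

ERRATUM (prover-2 g29, docstring only; declarations byte-identical to p732548): the previous wording «covers every member with a private AND
variable» omitted that third regime.
-/

set_option linter.dupNamespace false -- `Summit.PneNP.PneNP.…`: summit = sub-problem name (D-0017 single-conjunct layout)

open Finset Literature.Computability.Complexity
open Summit.PneNP.PneNP.Theorems.PstarFibrePolys (bit bit_injective)
open Summit.PneNP.PneNP.Theorems.PstarGapOneAll (gval)
open Summit.PneNP.PneNP.Theorems.PstarCoreBoundTargets (Terminal)
open Summit.PneNP.PneNP.Theorems.PstarUnion (SatPair)
open Summit.PneNP.PneNP.Theorems.PstarUnionCovers (TerminalNC)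
open Summit.PneNP.PneNP.Theorems.PstarMenuLocality (starSum bit_gval_update bit_gval_flip)
open Summit.PneNP.PneNP.Theorems.PstarLiteralPinning (Through InSlice)
open Summit.PneNP.PneNP.Theorems.PstarDirtyMemberSquare (InSliceBut inSlice_iff)
open Summit.PneNP.PneNP.Theorems.PstarClamp (clamp clamp_of_mem clamp_of_not_mem clamp_empty clamp_insert clamp_false_of
  starSum_clamp_of_unpaired)
open Summit.PneNP.PneNP.Theorems.PstarMemberKillCores (T3_of_not_satPair exists_sliceBut_of_satPair_erase)
open Summit.PneNP.PneNP.Theorems.PstarMultiSiblingSquare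

namespace Summit.PneNP.PneNP.Theorems.PstarMultiSiblingKill

variable {n m : ℕ} {I : LocalMap 4 n m} {y : Fin m → Bool} {K : Finset (Fin m)} {w₁ w₂ : Finset (Fin n) × Finset (Fin m) × Bool}
  {e : Fin m} {σ p : Fin n} {S : Finset (Fin m)} {q : Fin m → Fin n}

/-- Simple overlaps among the monomials of `Γ₂` give the uniqueness hypothesis of `gval_ne_on_sliceBut`. -/
theorem uniq_of_simple (p σ : Fin n) (S : Finset (Fin m)) (q : Fin m → Fin n) (hSG : ∀ g ∈ w₂.2.1, ∀ g' ∈ w₂.2.1, g' ≠ g →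
      ¬ ((I.vars g' 2 = I.vars g 2 ∧ I.vars g' 3 = I.vars g 3) ∨ (I.vars g' 2 = I.vars g 3 ∧ I.vars g' 3 = I.vars g 2))) :
    ∀ g ∈ w₂.2.1, ∀ u v : Fin n, (v = p ∨ v = σ ∨ ∃ o ∈ S, v = q o) →
      ((I.vars g 2 = v ∧ I.vars g 3 = u) ∨ (I.vars g 2 = u ∧ I.vars g 3 = v)) →
      ∀ g' ∈ w₂.2.1, g' ≠ g → ¬ ((I.vars g' 2 = v ∧ I.vars g' 3 = u) ∨ (I.vars g' 2 = u ∧ I.vars g' 3 = v)) := by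
  intro g hg u v _ hgs g' hg' hne' h
  apply hSG g hg g' hg' hne'
  rcases hgs with ⟨h2, h3⟩ | ⟨h2, h3⟩ <;> rcases h with ⟨h2', h3'⟩ | ⟨h2', h3'⟩
  · exact Or.inl ⟨h2'.trans h2.symm, h3'.trans h3.symm⟩
  · exact Or.inr ⟨h2'.trans h3.symm, h3'.trans h2.symm⟩
  · exact Or.inr ⟨h2'.trans h3.symm, h3'.trans h2.symm⟩
  · exact Or.inl ⟨h2'.trans h2.symm, h3'.trans h3.symm⟩

section Main

/-- Clamping sibling privates inside `Ā` at `x_σ = 0`, when their slopes vanish on `Ā`: stays in `Ā`, keeps `Γ₂`. -/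
theorem sliceBut_clamp_q (H : Setup I K w₁ w₂ e σ p S q) (hLq : ∀ o ∈ S, ∀ x' : Fin n → Bool, InSliceBut I y K e w₁ x' →
      (if q o ∈ w₂.1 then (1 : ZMod 2) else 0) + starSum I w₂.2.1 (q o) x' = 0)
    {T : Finset (Fin n)} (hT : T ⊆ S.image q) {x : Fin n → Bool} (hxσ : x σ = false) (hx : InSliceBut I y K e w₁ x) :
    InSliceBut I y K e w₁ (clamp T x) ∧ gval I w₂.1 w₂.2.1 (clamp T x) = gval I w₂.1 w₂.2.1 x := by
  induction T using Finset.induction_on with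
  | empty => rw [clamp_empty]; exact ⟨hx, rfl⟩
  | insert a T ha ih =>
    rw [clamp_insert]
    have hT' : T ⊆ S.image q := fun w hw => hT (mem_insert_of_mem hw)
    obtain ⟨o, ho, rfl⟩ := mem_image.1 (hT (mem_insert_self _ T))
    have h1 := ih hT'
    refine ⟨sliceBut_update_q H ho (clamp_false_of hxσ) h1.1 false, ?_⟩
    rw [← h1.2]
    apply bit_injective
    rw [bit_gval_update I H.pure, hLq o ho _ h1.1, mul_zero, add_zero]

/-- **`Γ₂` MISSES `b₂` ON ALL OF `Ā`** (hence (M0) fails at `e`).  (T3) on `A`; `A₁ ≠ ∅`; every `Γ₂`-gate through a block variable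
`v ∈ {p, σ} ∪ q(S)` is the only monomial with its pair, and its partner `u`, when off the block, is FROZEN on `Ā` or THAWED in `A₁`. -/
theorem gval_ne_on_sliceBut (H : Setup I K w₁ w₂ e σ p S q) (hT3 : ∀ z, InSlice I y K w₁ z → gval I w₂.1 w₂.2.1 z ≠ w₂.2.2)
    (hA₁ : ∃ z, InSlice I y K w₁ z ∧ z σ = false)
    (huniq : ∀ g ∈ w₂.2.1, ∀ u v : Fin n, (v = p ∨ v = σ ∨ ∃ o ∈ S, v = q o) →
      ((I.vars g 2 = v ∧ I.vars g 3 = u) ∨ (I.vars g 2 = u ∧ I.vars g 3 = v)) →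
      ∀ g' ∈ w₂.2.1, g' ≠ g → ¬ ((I.vars g' 2 = v ∧ I.vars g' 3 = u) ∨ (I.vars g' 2 = u ∧ I.vars g' 3 = v)))
    (hthaw : ∀ g ∈ w₂.2.1, ∀ u v : Fin n, (v = p ∨ v = σ ∨ ∃ o ∈ S, v = q o) →
      ((I.vars g 2 = v ∧ I.vars g 3 = u) ∨ (I.vars g 2 = u ∧ I.vars g 3 = v)) → u ≠ p → u ≠ σ → (∀ o ∈ S, u ≠ q o) →
      (∀ x x' : Fin n → Bool, InSliceBut I y K e w₁ x → InSliceBut I y K e w₁ x' → x u = x' u) ∨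
      (∃ z, (InSlice I y K w₁ z ∧ z σ = false) ∧ InSlice I y K w₁ (Function.update z u (!z u))))
    {x : Fin n → Bool} (hx : InSliceBut I y K e w₁ x) : gval I w₂.1 w₂.2.1 x ≠ w₂.2.2 := by
  have hσp := sigma_ne_p H
  obtain ⟨z₁, hz₁, hz₁σ⟩ := hA₁
  have hz₁b := ((inSlice_iff H.he).1 hz₁).1
  -- every gate partner of a block variable is off the block and frozen: same value at every point of `Ā` as at `z₁`
  have hfrozen : ∀ x' : Fin n → Bool, InSliceBut I y K e w₁ x' → ∀ g ∈ w₂.2.1, ∀ u v : Fin n, (v = p ∨ v = σ ∨ ∃ o ∈ S, v = q o) →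
      ((I.vars g 2 = v ∧ I.vars g 3 = u) ∨ (I.vars g 2 = u ∧ I.vars g 3 = v)) → x' u = z₁ u := by
    intro x' hx' g hg u v hv hgs
    have huv : u ≠ v := by
      rcases hgs with ⟨h2, h3⟩ | ⟨h2, h3⟩
      · exact fun huv => absurd (h2.trans (h3.trans huv).symm) fun h => absurd (H.pure.2 g h) (by decide)
      · exact fun huv => absurd ((h2.trans huv).trans h3.symm) fun h => absurd (H.pure.2 g h) (by decide)
    have hsymm : (I.vars g 2 = u ∧ I.vars g 3 = v) ∨ (I.vars g 2 = v ∧ I.vars g 3 = u) := hgs.elim (fun h => Or.inr h) fun h => Or.inl h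
    have huσ : u ≠ σ := by
      rintro rfl
      rcases hv with rfl | rfl | ⟨o, ho, rfl⟩
      · exact (H.hG₂ g hg).1 hsymm
      · exact huv rfl
      · exact (H.hG₂ g hg).2 o ho hsymm
    have hup : u ≠ p := by
      rintro rfl
      rcases hv with rfl | rfl | ⟨o, ho, rfl⟩
      · exact huv rfl
      · exact (H.hG₂ g hg).1 hgs
      · -- a gate `{q o, p}`: but `p` is thawed in `A₁`
        exact not_thawed_q H hT3 ho hg hgs (huniq g hg _ _ (Or.inr (Or.inr ⟨o, ho, rfl⟩)) hgs) hσp.symm hz₁ hz₁σ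
          (inSlice_update_p H hz₁σ hz₁ _)
    have huq : ∀ o ∈ S, u ≠ q o := by
      rintro o' ho' rfl
      rcases hv with rfl | rfl | ⟨o, ho, rfl⟩
      · -- a gate `{p, q o'}`: `q o'` is thawed in `A₁`
        exact not_thawed_p H hT3 hg hgs (huniq g hg _ _ (Or.inl rfl) hgs) (sigma_ne_q H ho').symm hz₁ hz₁σ
          (inSlice_update_q H ho' hz₁σ hz₁ _)
      · exact (H.hG₂ g hg).2 o' ho' hgs
      · -- a gate `{q o, q o'}`: `q o'` is thawed in `A₁`
        exact not_thawed_q H hT3 ho hg hgs (huniq g hg _ _ (Or.inr (Or.inr ⟨o, ho, rfl⟩)) hgs) (sigma_ne_q H ho').symm hz₁ hz₁σ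
          (inSlice_update_q H ho' hz₁σ hz₁ _)
    rcases hthaw g hg u v hv hgs hup huσ huq with hfr | ⟨z, ⟨hz, hzσ⟩, hz'⟩
    · exact hfr x' z₁ hx' hz₁b
    · exfalso
      rcases hv with rfl | rfl | ⟨o, ho, rfl⟩
      · exact not_thawed_p H hT3 hg hgs (huniq g hg _ _ (Or.inl rfl) hgs) huσ hz hzσ hz'
      · exact not_thawed_sigma H hT3 hg hgs (huniq g hg _ _ (Or.inr (Or.inl rfl)) hgs) hup huq huσ hz hzσ hz'
      · exact not_thawed_q H hT3 ho hg hgs (huniq g hg _ _ (Or.inr (Or.inr ⟨o, ho, rfl⟩)) hgs) huσ hz hzσ hz'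
  -- hence each slope is the same at every point of `Ā` as at `z₁`
  have hstar : ∀ v, (v = p ∨ v = σ ∨ ∃ o ∈ S, v = q o) → ∀ x' : Fin n → Bool, InSliceBut I y K e w₁ x' →
      starSum I w₂.2.1 v x' = starSum I w₂.2.1 v z₁ := by
    intro v hv x' hx'
    unfold PstarMenuLocality.starSum
    refine sum_congr rfl fun g hg => ?_
    by_cases h2 : I.vars g 2 = v
    · have h3 : I.vars g 3 ≠ v := fun h => absurd (h2.trans h.symm) fun h' => absurd (H.pure.2 g h') (by decide)
      rw [if_pos h2, if_pos h2, if_neg h3, if_neg h3, hfrozen x' hx' g hg (I.vars g 3) v hv (Or.inl ⟨h2, rfl⟩)]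
    · by_cases h3 : I.vars g 3 = v
      · rw [if_neg h2, if_neg h2, if_pos h3, if_pos h3, hfrozen x' hx' g hg (I.vars g 2) v hv (Or.inr ⟨rfl, h3⟩)]
      · rw [if_neg h2, if_neg h2, if_neg h3, if_neg h3]
  -- … and the slopes at `z₁` (for `σ`: at the normalised point `clamp ({p} ∪ q(S)) z₁`) vanish
  have hLp : ∀ x' : Fin n → Bool, InSliceBut I y K e w₁ x' → (if p ∈ w₂.1 then (1 : ZMod 2) else 0) + starSum I w₂.2.1 p x' = 0 :=
    fun x' hx' => by rw [hstar p (Or.inl rfl) x' hx']; exact slope_p_zero H hT3 hz₁ hz₁σ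
  have hLq : ∀ o ∈ S, ∀ x' : Fin n → Bool, InSliceBut I y K e w₁ x' →
      (if q o ∈ w₂.1 then (1 : ZMod 2) else 0) + starSum I w₂.2.1 (q o) x' = 0 :=
    fun o ho x' hx' => by rw [hstar (q o) (Or.inr (Or.inr ⟨o, ho, rfl⟩)) x' hx']; exact slope_q_zero H hT3 ho hz₁ hz₁σ
  have hLσ : ∀ x' : Fin n → Bool, InSliceBut I y K e w₁ x' → (if σ ∈ w₂.1 then (1 : ZMod 2) else 0) + starSum I w₂.2.1 σ x' = 0 := by
    intro x' hx'
    set N := insert p (S.image q) with hN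
    have hz₀A : InSlice I y K w₁ (clamp N z₁) := inSlice_clamp H subset_rfl hz₁σ hz₁
    have h0 := slope_sigma_zero H hT3 hz₀A (clamp_of_mem (mem_insert_self _ _) z₁)
      fun o ho => clamp_of_mem (mem_insert_of_mem (mem_image_of_mem q ho)) z₁
    -- no gate pairs `σ` with `p` or a `q o`, so the partner sum of `σ` ignores the normalisation
    have hunp : starSum I w₂.2.1 σ (clamp N z₁) = starSum I w₂.2.1 σ z₁ := by
      refine starSum_clamp_of_unpaired _ z₁ fun g hg => ⟨fun h2 h3 => ?_, fun h3 h2 => ?_⟩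
      · rcases mem_insert.1 h3 with h3 | h3
        · exact (H.hG₂ g hg).1 (Or.inl ⟨h2, h3⟩)
        · obtain ⟨o, ho, hoq⟩ := mem_image.1 h3
          exact (H.hG₂ g hg).2 o ho (Or.inl ⟨h2, hoq.symm⟩)
      · rcases mem_insert.1 h2 with h2 | h2
        · exact (H.hG₂ g hg).1 (Or.inr ⟨h2, h3⟩)
        · obtain ⟨o, ho, hoq⟩ := mem_image.1 h2
          exact (H.hG₂ g hg).2 o ho (Or.inr ⟨hoq.symm, h3⟩)
    rw [hunp] at h0
    rw [hstar σ (Or.inr (Or.inl rfl)) x' hx']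
    exact h0
  -- ENDGAME.  Propagate along free moves from `x` to a point of `A`, where (T3) bites.
  have hneb : ∀ a b : Bool, a ≠ b → (!a) = b := by decide
  by_cases hxσ : x σ = true
  · -- flip `p`: one of the two points solves `e`
    set x' := Function.update x p (!x p) with hx'd
    have hx' : InSliceBut I y K e w₁ x' := sliceBut_update_p H hx _
    have hΓ : gval I w₂.1 w₂.2.1 x' = gval I w₂.1 w₂.2.1 x := by
      apply bit_injective
      rw [hx'd, bit_gval_flip I H.pure, hLp x hx, add_zero]
    have hev : I.eval x' e = !I.eval x e := by
      rw [eval_e H, eval_e H, hx'd, Function.update_of_ne (H.hX e H.he).2.2.1, Function.update_of_ne (H.hX e H.he).2.2.2.1,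
        Function.update_of_ne hσp, Function.update_self, hxσ, Bool.true_and, Bool.true_and, Bool.xor_not]
    by_cases hA : I.eval x e = y e
    · exact hT3 x ((inSlice_iff H.he).2 ⟨hx, hA⟩)
    · rw [← hΓ]
      exact hT3 x' ((inSlice_iff H.he).2 ⟨hx', by rw [hev]; exact hneb _ _ hA⟩)
  · rw [Bool.not_eq_true] at hxσ
    -- set `p := 1` (free), clamp every `q o := 0` (free), then flip `σ` if needed
    set x₁ := Function.update x p true with hx₁d
    have hx₁ : InSliceBut I y K e w₁ x₁ := sliceBut_update_p H hx _
    have hx₁σ : x₁ σ = false := by rw [hx₁d, Function.update_of_ne hσp]; exact hxσ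
    have hΓ₁ : gval I w₂.1 w₂.2.1 x₁ = gval I w₂.1 w₂.2.1 x := by
      apply bit_injective
      rw [hx₁d, bit_gval_update I H.pure, hLp x hx, mul_zero, add_zero]
    set x₂ := clamp (S.image q) x₁ with hx₂d
    have hx₂all := sliceBut_clamp_q H hLq subset_rfl hx₁σ hx₁
    have hx₂ : InSliceBut I y K e w₁ x₂ := hx₂all.1
    have hΓ₂ : gval I w₂.1 w₂.2.1 x₂ = gval I w₂.1 w₂.2.1 x₁ := hx₂all.2
    have hx₂σ : x₂ σ = false := clamp_false_of hx₁σ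
    have hx₂p : x₂ p = true := by rw [hx₂d, clamp_of_not_mem (p_not_mem_image H), hx₁d, Function.update_self]
    have hx₂q : ∀ o ∈ S, x₂ (q o) = false := fun o ho => clamp_of_mem (mem_image_of_mem q ho) x₁
    by_cases hA : I.eval x₂ e = y e
    · rw [← hΓ₁, ← hΓ₂]
      exact hT3 x₂ ((inSlice_iff H.he).2 ⟨hx₂, hA⟩)
    · set x₃ := Function.update x₂ σ true with hx₃d
      have hx₃ : InSliceBut I y K e w₁ x₃ := sliceBut_update_sigma H hx₂q hx₂ _
      have hΓ₃ : gval I w₂.1 w₂.2.1 x₃ = gval I w₂.1 w₂.2.1 x₂ := by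
        apply bit_injective
        rw [hx₃d, bit_gval_update I H.pure, hLσ x₂ hx₂, mul_zero, add_zero]
      have hev : I.eval x₃ e = !I.eval x₂ e := by
        rw [eval_e H, eval_e H, hx₃d, Function.update_of_ne (H.hX e H.he).1, Function.update_of_ne (H.hX e H.he).2.1,
          Function.update_self, Function.update_of_ne hσp.symm, hx₂p, hx₂σ, Bool.true_and, Bool.false_and, Bool.xor_false,
          Bool.xor_true]
      rw [← hΓ₁, ← hΓ₂, ← hΓ₃]
      exact hT3 x₃ ((inSlice_iff H.he).2 ⟨hx₃, by rw [hev]; exact hneb _ _ hA⟩)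

/-- **(T3) + (M0) AT A MEMBER WITH FROZEN-OR-THAWED GATE PARTNERS IS CONTRADICTORY** (any number of siblings): simple overlaps among the
monomials of `Γ₂`, `A₁ ≠ ∅`, every off-block gate partner of a block variable frozen on `Ā` or thawed in `A₁`, `¬ SatPair K` ((T3)) and
`SatPair (K ∖ e)` ((M0) at `e`). -/
theorem false_of_multi_sibling (H : Setup I K w₁ w₂ e σ p S q) (hSG : ∀ g ∈ w₂.2.1, ∀ g' ∈ w₂.2.1, g' ≠ g →
      ¬ ((I.vars g' 2 = I.vars g 2 ∧ I.vars g' 3 = I.vars g 3) ∨ (I.vars g' 2 = I.vars g 3 ∧ I.vars g' 3 = I.vars g 2)))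
    (hA₁ : ∃ z, InSlice I y K w₁ z ∧ z σ = false)
    (hthaw : ∀ g ∈ w₂.2.1, ∀ u v : Fin n, (v = p ∨ v = σ ∨ ∃ o ∈ S, v = q o) →
      ((I.vars g 2 = v ∧ I.vars g 3 = u) ∨ (I.vars g 2 = u ∧ I.vars g 3 = v)) → u ≠ p → u ≠ σ → (∀ o ∈ S, u ≠ q o) →
      (∀ x x' : Fin n → Bool, InSliceBut I y K e w₁ x → InSliceBut I y K e w₁ x' → x u = x' u) ∨
      (∃ z, (InSlice I y K w₁ z ∧ z σ = false) ∧ InSlice I y K w₁ (Function.update z u (!z u))))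
    (hT3 : ¬ SatPair I y K w₁ w₂) (hM0 : SatPair I y (K.erase e) w₁ w₂) : False := by
  obtain ⟨x, hx, hx₂⟩ := exists_sliceBut_of_satPair_erase hM0
  exact gval_ne_on_sliceBut H (T3_of_not_satPair hT3) hA₁ (uniq_of_simple p σ S q hSG) hthaw hx hx₂

/-- **THE MULTI-SIBLING MEMBER KILL**: under the hypotheses of `false_of_multi_sibling` the pair `(K; Γ₁, Γ₂)` is not terminal. -/
theorem not_terminal_of_multi_sibling (H : Setup I K w₁ w₂ e σ p S q) {r : ℕ} (hSG : ∀ g ∈ w₂.2.1, ∀ g' ∈ w₂.2.1, g' ≠ g →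
      ¬ ((I.vars g' 2 = I.vars g 2 ∧ I.vars g' 3 = I.vars g 3) ∨ (I.vars g' 2 = I.vars g 3 ∧ I.vars g' 3 = I.vars g 2)))
    (hA₁ : ∃ z, InSlice I y K w₁ z ∧ z σ = false)
    (hthaw : ∀ g ∈ w₂.2.1, ∀ u v : Fin n, (v = p ∨ v = σ ∨ ∃ o ∈ S, v = q o) →
      ((I.vars g 2 = v ∧ I.vars g 3 = u) ∨ (I.vars g 2 = u ∧ I.vars g 3 = v)) → u ≠ p → u ≠ σ → (∀ o ∈ S, u ≠ q o) →
      (∀ x x' : Fin n → Bool, InSliceBut I y K e w₁ x → InSliceBut I y K e w₁ x' → x u = x' u) ∨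
      (∃ z, (InSlice I y K w₁ z ∧ z σ = false) ∧ InSlice I y K w₁ (Function.update z u (!z u)))) :
    ¬ Terminal I r y K w₁ w₂ := by
  intro ht
  obtain ⟨-, -, -, -, -, -, hT3, hM0⟩ := ht
  exact false_of_multi_sibling H hSG hA₁ hthaw hT3 (hM0 e H.he)

/-- **The same for minimal cores (`TerminalNC`).** -/
theorem not_terminalNC_of_multi_sibling (H : Setup I K w₁ w₂ e σ p S q) {r : ℕ} (hSG : ∀ g ∈ w₂.2.1, ∀ g' ∈ w₂.2.1, g' ≠ g →
      ¬ ((I.vars g' 2 = I.vars g 2 ∧ I.vars g' 3 = I.vars g 3) ∨ (I.vars g' 2 = I.vars g 3 ∧ I.vars g' 3 = I.vars g 2)))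
    (hA₁ : ∃ z, InSlice I y K w₁ z ∧ z σ = false)
    (hthaw : ∀ g ∈ w₂.2.1, ∀ u v : Fin n, (v = p ∨ v = σ ∨ ∃ o ∈ S, v = q o) →
      ((I.vars g 2 = v ∧ I.vars g 3 = u) ∨ (I.vars g 2 = u ∧ I.vars g 3 = v)) → u ≠ p → u ≠ σ → (∀ o ∈ S, u ≠ q o) →
      (∀ x x' : Fin n → Bool, InSliceBut I y K e w₁ x → InSliceBut I y K e w₁ x' → x u = x' u) ∨
      (∃ z, (InSlice I y K w₁ z ∧ z σ = false) ∧ InSlice I y K w₁ (Function.update z u (!z u)))) :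
    ¬ TerminalNC I r y K w₁ w₂ := fun ht =>
  false_of_multi_sibling H hSG hA₁ hthaw ht.2.2.2.2.2.1 (ht.2.2.2.2.2.2 e H.he)

/-- **`Γ₂` MUST TOUCH THE BLOCK.**  If no monomial of `Γ₂` passes through `σ`, `p` or any `q o` and `A₁ ≠ ∅` (`σ` unpinned), then `¬ SatPair K`
and `SatPair (K ∖ e)` are contradictory — no simple-overlap or freeze/thaw hypothesis needed. -/
theorem false_of_untouched (H : Setup I K w₁ w₂ e σ p S q) (huntouched : ∀ g ∈ w₂.2.1, ¬ Through I σ g ∧ ¬ Through I p g ∧ ∀ o ∈ S, ¬ Through I (q o) g)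
    (hA₁ : ∃ z, InSlice I y K w₁ z ∧ z σ = false) (hT3 : ¬ SatPair I y K w₁ w₂) (hM0 : SatPair I y (K.erase e) w₁ w₂) : False := by
  have hno : ∀ g ∈ w₂.2.1, ∀ u v : Fin n, (v = p ∨ v = σ ∨ ∃ o ∈ S, v = q o) →
      ¬ ((I.vars g 2 = v ∧ I.vars g 3 = u) ∨ (I.vars g 2 = u ∧ I.vars g 3 = v)) := by
    intro g hg u v hv hgs
    have hth : Through I v g := hgs.elim (fun h => Or.inl h.1) fun h => Or.inr h.2
    rcases hv with rfl | rfl | ⟨o, ho, rfl⟩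
    exacts [(huntouched g hg).2.1 hth, (huntouched g hg).1 hth, (huntouched g hg).2.2 o ho hth]
  obtain ⟨x, hx, hx₂⟩ := exists_sliceBut_of_satPair_erase hM0
  exact gval_ne_on_sliceBut H (T3_of_not_satPair hT3) hA₁ (fun g hg u v hv hgs => absurd hgs (hno g hg u v hv))
    (fun g hg u v hv hgs => absurd hgs (hno g hg u v hv)) hx hx₂

/-- **`Γ₂` must touch the block** — `Terminal` form. -/
theorem not_terminal_of_untouched (H : Setup I K w₁ w₂ e σ p S q) {r : ℕ} (huntouched : ∀ g ∈ w₂.2.1, ¬ Through I σ g ∧ ¬ Through I p g ∧ ∀ o ∈ S, ¬ Through I (q o) g)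
    (hA₁ : ∃ z, InSlice I y K w₁ z ∧ z σ = false) : ¬ Terminal I r y K w₁ w₂ := by
  intro ht
  obtain ⟨-, -, -, -, -, -, hT3, hM0⟩ := ht
  exact false_of_untouched H huntouched hA₁ hT3 (hM0 e H.he)

/-- **`Γ₂` must touch the block** — `TerminalNC` form. -/
theorem not_terminalNC_of_untouched (H : Setup I K w₁ w₂ e σ p S q) {r : ℕ} (huntouched : ∀ g ∈ w₂.2.1, ¬ Through I σ g ∧ ¬ Through I p g ∧ ∀ o ∈ S, ¬ Through I (q o) g)
    (hA₁ : ∃ z, InSlice I y K w₁ z ∧ z σ = false) : ¬ TerminalNC I r y K w₁ w₂ := fun ht =>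
  false_of_untouched H huntouched hA₁ ht.2.2.2.2.2.1 (ht.2.2.2.2.2.2 e H.he)

end Main

end Summit.PneNP.PneNP.Theorems.PstarMultiSiblingKill
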